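import Literature.NumberTheory.Automorphic.UnitaryGroupArchCharacterTraceClassOfKTypeGrowth
import Literature.NumberTheory.Automorphic.UnitaryGroupArchIntegratedOperatorNuclearProofs
import HarnessLib

/-!
# The trace-class letter A5 from the `U(2,1)` INSTANCE of the `K`-type growth letter V19 alone (V22 being paid in-house)

Topic `NumberTheory/Automorphic`; namespace `Literature.NumberTheory.Automorphic.UnitaryGroup`; theorems only (no definition, no named fact, no instance, no `sorry`).  Cell
`hodgecm-mathlib`, line T1a, road HC (lead F0P3b-p01 (g2)).  ★ C1 `archIntegratedOperatorTraceClass_forall_of_nuclearOfKTypeGrowth` (p829956) consumes the letter ★ V19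
`IrreducibleUnitaryKTypeGrowth` for ALL `U(p,q)`, but only USES it at `(p,q) = (2,1)`; the in-house road to V19 (nodes N0–N5: Dixmier quasi-simplicity ★ p830646, the
`𝔭`-filtration, the Casimir symbol, the multiplicity-free harmonics of `U(2,1)`) proves the `(2,1)` instance only.  This file states the composition with exactly that
instance as hypothesis — spelled out, no new definition — and with V22 supplied by the in-house theorem ★ `archIntegratedOperatorNuclearOfKTypeGrowth_holds` (p831076), so that
a future edition of the Lines file can fold `stub_traceClass` onto a `U(2,1)`-only K-type growth stub∕theorem by name.

* `archIntegratedOperatorTraceClass_of_kTypeGrowthU21` — one frame; `archIntegratedOperatorTraceClass_forall_of_kTypeGrowthU21` — all frames (the TYPE of `stub_traceClass`).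

HONEST LABEL: the hypothesis is the `(2,1)` instance of the booked letter V19 [Varadarajan1989 §5.4 Thm 19 = HarishChandra1954]; nothing printed is discharged here.
HC_CM is proved only modulo the 2 remaining named inputs (hLiu418, h413) until rung 0 closes.

## References
* V. S. Varadarajan, *An Introduction to Harmonic Analysis on Semisimple Lie Groups* (1989), §5.4 Thm. 19, Thm. 22 [Varadarajan1989].
* A. W. Knapp, *Representation Theory of Semisimple Groups: An Overview Based on Examples* (1986), Thm. 10.2 [Knapp1986].
-/

set_option autoImplicit false

noncomputable section

open NumberField MeasureTheory CompactlySupported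
-- `Classical`: the place subtypes indexing `mixedSpace L` are `Fintype` classically, as in ★ `UnitaryGroupArchCharacterTraceClass` (token-for-token binder match).
open scoped Matrix InnerProductSpace ENNReal NNReal Classical

namespace Literature.NumberTheory.Automorphic.UnitaryGroup

open Literature.RepresentationTheory.KonnoKonno2007 Literature.RepresentationTheory.KonnoKonno2007.RealDualPair

/-- **A5 at one frame ⇐ the `U(2,1)` instance of V19** (V22 in-house): if every unitary globalization `ϖ` of an irreducible `(𝔤, K)`-class of `U(2,1)` has finite-dimensional
`K`-isotypic subspaces with `dim E(τ) ≤ c·d(τ)²`, then ★ `ArchIntegratedOperatorTraceClass L ι H T hT νinf`. [cite: Varadarajan1989, §5.4 Thm. 19 and Thm. 22] [cite: Knapp1986, Thm. 10.2] -/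
theorem archIntegratedOperatorTraceClass_of_kTypeGrowthU21
    (L : Type) [Field L] [NumberField L] [IsCMField L] (ι : L →+* ℂ) (H : Matrix (Fin 3) (Fin 3) L) (T : GL (Fin 3) ℂ)
    (hT : (T : Matrix (Fin 3) (Fin 3) ℂ)ᴴ * H.map ι * (T : Matrix (Fin 3) (Fin 3) ℂ) = Literature.Geometry.ComplexHyperbolic.BallModel.J)
    (νinf : @Measure (arch (↥(maximalRealSubfield L)) L (IsCMField.complexConj L) 3 H) (borel _))
    (h19 : ∀ (x : GKIrrClass (uFormGroup (Fin 2) (Fin 1)))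
      (E : Type) [NormedAddCommGroup E] [InnerProductSpace ℂ E] [CompleteSpace E]
      (ϖ : ContRepresentation ℂ (uFormGroup (Fin 2) (Fin 1)).carrier E),
      IsUnitaryGlobalization (uFormGroup (Fin 2) (Fin 1)) x ϖ →
      ∃ c : ℝ, ∀ (W : Type) [AddCommGroup W] [Module ℂ W] [FiniteDimensional ℂ W]
        (τ : Representation ℂ (uFormGroup (Fin 2) (Fin 1)).maximalCompact W), τ.IsIrreducible →
        FiniteDimensional ℂ (Representation.homRangeSum
            (ϖ.restrict (Subgroup.inclusion (uFormGroup (Fin 2) (Fin 1)).maximalCompact_le_carrier)).toRepresentation τ) ∧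
          (Module.finrank ℂ (Representation.homRangeSum
              (ϖ.restrict (Subgroup.inclusion (uFormGroup (Fin 2) (Fin 1)).maximalCompact_le_carrier)).toRepresentation τ) : ℝ) ≤
            c * (Module.finrank ℂ W : ℝ) ^ 2) :
    ArchIntegratedOperatorTraceClass L ι H T hT νinf :=
  archIntegratedOperatorTraceClass_of_summable_norm_apply L ι H T hT νinf fun hν x E _ _ _ ϖ hϖ φ hφc hφs hφ' => by
    obtain ⟨c, hc⟩ := h19 x E ϖ hϖ
    exact (archIntegratedOperatorNuclearOfKTypeGrowth_holds L ι H T hT νinf).summable_norm_apply_of_isUnitaryGlobalization L ι H T hT hν x E ϖ hϖ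
      ⟨c, 2, fun W _ _ _ τ hτ => hc W τ hτ⟩ φ hφc hφs hφ'

/-- **A5 at ALL frames ⇐ the `U(2,1)` instance of V19** — the TYPE of the Lines stub `stub_traceClass` from the `(2,1)` K-type growth statement alone (V22 in-house ★ p831076):
the junction a future edition uses when the in-house `U(2,1)` road to V19 (N0–N5) closes. [cite: Varadarajan1989, §5.4 Thm. 19 and Thm. 22] [cite: Knapp1986, Thm. 10.2] -/
theorem archIntegratedOperatorTraceClass_forall_of_kTypeGrowthU21
    (h19 : ∀ (x : GKIrrClass (uFormGroup (Fin 2) (Fin 1)))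
      (E : Type) [NormedAddCommGroup E] [InnerProductSpace ℂ E] [CompleteSpace E]
      (ϖ : ContRepresentation ℂ (uFormGroup (Fin 2) (Fin 1)).carrier E),
      IsUnitaryGlobalization (uFormGroup (Fin 2) (Fin 1)) x ϖ →
      ∃ c : ℝ, ∀ (W : Type) [AddCommGroup W] [Module ℂ W] [FiniteDimensional ℂ W]
        (τ : Representation ℂ (uFormGroup (Fin 2) (Fin 1)).maximalCompact W), τ.IsIrreducible →
        FiniteDimensional ℂ (Representation.homRangeSum
            (ϖ.restrict (Subgroup.inclusion (uFormGroup (Fin 2) (Fin 1)).maximalCompact_le_carrier)).toRepresentation τ) ∧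
          (Module.finrank ℂ (Representation.homRangeSum
              (ϖ.restrict (Subgroup.inclusion (uFormGroup (Fin 2) (Fin 1)).maximalCompact_le_carrier)).toRepresentation τ) : ℝ) ≤
            c * (Module.finrank ℂ W : ℝ) ^ 2) :
    ∀ (L : Type) [Field L] [NumberField L] [IsCMField L] (ι : L →+* ℂ) (H : Matrix (Fin 3) (Fin 3) L) (T : GL (Fin 3) ℂ)
      (hT : (T : Matrix (Fin 3) (Fin 3) ℂ)ᴴ * H.map ι * (T : Matrix (Fin 3) (Fin 3) ℂ) = Literature.Geometry.ComplexHyperbolic.BallModel.J)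
      (νinf : @Measure (arch (↥(maximalRealSubfield L)) L (IsCMField.complexConj L) 3 H) (borel _)),
      ArchIntegratedOperatorTraceClass L ι H T hT νinf :=
  fun L _ _ _ ι H T hT νinf => archIntegratedOperatorTraceClass_of_kTypeGrowthU21 L ι H T hT νinf h19

/-- **V19 ⇒ its `(2,1)` instance** (for the record: the booked letter ★ `IrreducibleUnitaryKTypeGrowth` implies the hypothesis above). [cite: Varadarajan1989, §5.4 Thm. 19] -/
theorem kTypeGrowthU21_of_irreducibleUnitaryKTypeGrowth (h19 : IrreducibleUnitaryKTypeGrowth) :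
    ∀ (x : GKIrrClass (uFormGroup (Fin 2) (Fin 1)))
      (E : Type) [NormedAddCommGroup E] [InnerProductSpace ℂ E] [CompleteSpace E]
      (ϖ : ContRepresentation ℂ (uFormGroup (Fin 2) (Fin 1)).carrier E),
      IsUnitaryGlobalization (uFormGroup (Fin 2) (Fin 1)) x ϖ →
      ∃ c : ℝ, ∀ (W : Type) [AddCommGroup W] [Module ℂ W] [FiniteDimensional ℂ W]
        (τ : Representation ℂ (uFormGroup (Fin 2) (Fin 1)).maximalCompact W), τ.IsIrreducible →
        FiniteDimensional ℂ (Representation.homRangeSum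
            (ϖ.restrict (Subgroup.inclusion (uFormGroup (Fin 2) (Fin 1)).maximalCompact_le_carrier)).toRepresentation τ) ∧
          (Module.finrank ℂ (Representation.homRangeSum
              (ϖ.restrict (Subgroup.inclusion (uFormGroup (Fin 2) (Fin 1)).maximalCompact_le_carrier)).toRepresentation τ) : ℝ) ≤
            c * (Module.finrank ℂ W : ℝ) ^ 2 :=
  fun x E _ _ _ ϖ hϖ => h19 (Fin 2) (Fin 1) x E ϖ hϖ

end Literature.NumberTheory.Automorphic.UnitaryGroup

end
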